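import Summits.QuantumFields.BalabanUV.T4Continuum.Support.NE7SoftDataPathGenericSlice
import Summits.QuantumFields.BalabanUV.T4Continuum.Support.NE7OneStepOfRoutePi
import HarnessLib

/-!
# GEN 99 RE-THREAD (`…Slice`, Bałaban-slice road, memo `t4/b2b-balaban-t4-ne7-p1-g99/ROAD-G99.md` §3.5 ∕ §3.8): this file is `NE7OneStepOfDecomposition`'s CHAIN THEOREM VERBATIM except that
# the slice `T_♮(U♯) = frameFreeBlockLandauW` of the per-pair binder is replaced by an ABSTRACT SLICE FAMILY `𝒯 k U♯` with the two hypotheses (hT) «tangent-critical ⟹ critical on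
# `𝒯 j W`» and (hP) «class SlicePoincare for `𝒯 j W`» in the generic theorems, and by the corner-free energy block-Landau slice `𝒯_E = energyBlockLandauW` (both hypotheses
# DISCHARGED: `hT_energyBlockLandau`, `classSlicePoincare_energyBlockLandau_SU2`, constant `8·CPLine 4 2 2 10⁻¹⁷ 10⁻⁵³ + 1`) in the SU(2) `d = 4` `L = 2` theorems; chain predecessors are
# the `…Slice` ∕ `…GenericSlice` re-issues (lineage `b2b-balaban-t4-ne7-p1` gen 99, CRUX PROVER NE7 #1).  NOT NE7; spine 0∕9.  Original docstring follows.

# Support | NE7 (F327): ONE-STEP for all sufficiently small data ⇐ (APE) ∧ THE HONEST PER-PAIR BINDER `hdecomp` (decomposition `X = X_T + X_N` with its two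
# energy letters and k-free currencies) — F31 `NE7OneStepOfRoutePi` RE-ISSUED with row NE3's weight currency REMOVED from the per-pair binder

Cell `pub-balaban`, rung (B)+1 sub-cell t4, lineage `b2b-balaban-t4-ne7-p1` (CRUX PROVER NE7 #1 = OWNER of row NE7), generation 95; memo
`t4/b2b-balaban-t4-ne7-p1-g95/WEIGHT-CURRENCY-DEAD.md`.  Over F29 `NE7SoftDataPath.oneStep_of_dataClass_ape_repWgauge` and F326 `NE7RepWGaugeOfDecomposition.hrep_of_hdecomp`;
the SU(2) packaging reuses F31's dischargers BY NAME (`classSlicePoincare_SU2'`, `levelSmall_all_d4_L2`, `classSmall_d4_L2`).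

WHY.  F31's per-pair binder `hleaves` (the residual slice representative + a square-summable WEIGHT with the blockwise quadratic letter, threaded verbatim up to the END OF
RECORD F324) is not dischargeable for arbitrary admissible `U′`: its weight currency forces `dirL1 (D X₀) ≤ C₂Ĉ²·M^{2−d}·dirSq X₀`, which fails for non-abelian corner-localised
slice fields by the frame-carried corner cross term of the averaging remainder (numerics of gen 95, kit j332481 ∕ j332484: M-independent response `0.171` (d=3), `0.0140` (d=4)
against an allowance `∝ M^{2−d}`).  What F29 CONSUMES is only the decomposition with its two ENERGY letters.  THIS FILE is F31 with that honest binder: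
§1 **`oneStep_of_dataClass_ape_decomp`** (generic `d`, `L ≥ 2`, every `N ≥ 1`): uniform hypotheses = F29's class ∕ level ∕ (P♮)_W data, ceilings `α̂, ν̂ ≥ 0, κ̂` and ONE k-free
   strict line `2κ̂ < ((((1∕2 − ν̂²)∕(2(1+CP)) − ν̂²)∕2 − 576d·α̂²e^{2α̂})∕card n − 28d(ε + 7α̂²))`; (APE) on the data class `𝒟_β`; PER PAIR `(U♯, U′)` (U♯ admissible,
   `SmallField U♯ (δ₁M⁻²)`, tangent-critical; U′ admissible): `∃ u X X_T X_N α ν κ` — `u` unitary, `U′^{u} = U♯·e^{X}`, `X` skew `(N·M)`-periodic with `sup ≤ α`,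
   `X = X_T + X_N`, `X_T ∈ T_♮(U♯)`, `X_N` skew, `‖X_N‖_w ≤ ν‖X‖_w`, `(ε∕M²)·Σ_{perWin}‖curl_{U♯}X_N‖ ≤ κ‖X‖_w²`, `αM ≤ α̂`, `ν ≤ ν̂`, `κ ≤ κ̂`.
§2 **`oneStep_SU2_of_dataClass_ape_decomp`** — `d = 4`, `L = 2`, `card n = 2`, `0 < ε ≤ 10⁻⁵³`: (P♮)_W ∕ levels ∕ class smallness discharged as in F31 §2.
SUPPLIERS of the binder: F326 `decomp_of_directLetters` (exact slice representative + the DIRECT ℓ²∕ℓ¹ letters of the linearised average), or any approximate slice fixing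
whose gauge residue is absorbed in `X_N`.  The sup half of the representative is gen 94's `NE7PairResidualSupRep.pair_residual_sup_rep`.
HONEST FRAMING (page 1): composition over HYPOTHESES; (APE) ([Balaban1985Variational] Sect. F TYPE; discharged downstream of F31 by gens 70–93 — to be re-threaded over this file),
the decomposition binder ([Balaban1985Variational] Prop. 2 ∕ [Balaban1985RegularSpaces] Thm 2 TYPE in our energy currency) and the numeric line are asserted for nothing;
NOT ONE-STEP, NOT NE7; spine 0∕9; finite T⁴ rung (B)+1 — NOT infinite volume, NOT mass gap, NOT `BetaPertH`, NOT Clay.  Continuum YM on T⁴ ⇐ BetaPertH ∧ nine spine estimates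
(0/9 proved); BetaPertH ⇐ (D1) ∧ (D4) ∧ CAP+tail; G-an2-4 gates asym, D1 and NE2/3/4.  0 def, 0 sorry.
-/

set_option autoImplicit false

open scoped BigOperators Matrix Matrix.Norms.L2Operator
open NormedSpace Finset Set

namespace Summit.QuantumFields.BalabanUV.T4Continuum.NE7OneStepOfDecompositionSlice

open Literature.MathematicalPhysics.QuantumFieldTheory.Balaban1983to89
open B7Prop1Explicit B7Prop2Explicit
open T4AveragingDeficitWall (IsUnitaryCfg IsSkewDir SmallField vary curl curlSq dirSq dirL1)
open T4AveragingDeficitWallBoundary (IsPeriodicCfg periodBox)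
open AveragingDeficitPeriodicCounting (IsPeriodicDir)
open AveragingDeficitMultiLevelPrep (LevelSmall tower TangentIter)
open MinimalActionLevels (perWin)
open MinimalActionSandwich (IsMinimiser admissible)
open MinimalActionRate (sfClass)
open NE3HessForm (dAction)
open NE3SlicePoincareShape (SlicePoincare slicePoincare_mono)
open NE3SlicePoincareBudgetLine (CPLine)
open NE3ClassRadiusFamily (CPLine_nonneg_d4_L2)
open NE7MeanZeroGaugeSliceW (energyBlockLandauW)
open NE7EnergyBlockLandauClassPoincare (classSlicePoincare_energyBlockLandau_SU2)
open NE7ConvOneStepGenericSlice (hT_energyBlockLandau)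
open NE3EnergyShapes (IsUnitarySite)
open NE3EnergyWeightedShapes (energyNormW)
open NE7ConvOneStepSU2 (levelSmall_all_d4_L2)
open NE7OneStepOfPathOpen (classSmall_d4_L2)
open NE7SoftDataPathGenericSlice (oneStep_of_dataClass_ape_rep_generic_gauge)
open NE7OneStepGenericSlicePath (hrep_of_hdecomp_generic)
open T4AveragingDeficitWall (Plaq)

noncomputable section

variable {d : ℕ} {n : Type*} [Fintype n] [DecidableEq n]

/-! ## §1 The END over the data class with the honest per-pair binder -/

/-- **ONE-STEP FOR ALL SUFFICIENTLY SMALL DATA ⇐ (APE) ∧ THE DECOMPOSITION BINDER `hdecomp` ON THE DATA CLASS `𝒟_β`** (generic `d`, `L ≥ 2`, every `N ≥ 1`; see the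
module docstring §1 for the reading of every hypothesis). [folklore] -/
theorem oneStep_of_dataClass_ape_decomp [Nonempty n] {L N : ℕ} [NeZero L] [NeZero N] (hL : 2 ≤ L) (hN : 1 ≤ N) {ε δ δ₁ CP β : ℝ}
    (hε : 0 < ε) (hε1 : 16 * C0 d * ε ≤ 3) (hε2 : 1024 * (d + 1) * (d + 4) * (L : ℝ) ^ 2 * ε ≤ 1) (hδ₁ : 0 ≤ δ₁) (hδ₁δ : δ₁ < δ) (hδε : δ < ε)
    (hCP : 0 < CP) (hβ : 0 < β) (hls : ∀ k : ℕ, LevelSmall d L k (ε / ((L : ℝ) ^ (k + 1)) ^ 2))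
    (𝒯 : ℕ → (Site d → Fin d → (Matrix n n ℂ)ˣ) → Set (Site d → Fin d → Matrix n n ℂ))
    (hT : ∀ (j : ℕ) (W : Site d → Fin d → (Matrix n n ℂ)ˣ), W ∈ sfClass d L N ε (j + 1) → ∀ F : Finset (Plaq d),
      (∀ φ : Site d → Fin d → Matrix n n ℂ, IsSkewDir φ → IsPeriodicDir φ ((tower L N (j + 1) : ℕ) : ℤ) → TangentIter L j W φ → dAction W φ F = 0) →
      ∀ Y ∈ 𝒯 j W, dAction W Y F = 0)
    (hP : ∀ (j : ℕ) (W : Site d → Fin d → (Matrix n n ℂ)ˣ), W ∈ sfClass d L N ε (j + 1) →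
      SlicePoincare L (j + 1) W (𝒯 j W) CP (periodBox (d := d) (N * L ^ (j + 1))))
    -- the k-free ceilings and ONE k-free strict line
    {αh νh κh : ℝ}
    (hline : 2 * κh < ((((1 / 2 - νh ^ 2) / (2 * (1 + CP)) - νh ^ 2) / 2 - 576 * d * (αh ^ 2 * Real.exp (2 * αh))) / (Fintype.card n : ℝ)
        - 28 * d * (ε + 7 * αh ^ 2)))
    -- (APE) on the data class
    (hape : ∀ D : Site d → Fin d → (Matrix n n ℂ)ˣ, IsUnitaryCfg D → IsPeriodicCfg D (N : ℤ) → SmallField D (4 * (Real.exp β - 1)) →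
      ∀ (k : ℕ), ∀ U ∈ admissible (sfClass d L N ε) L (k + 1) D, SmallField U (δ / ((L : ℝ) ^ (k + 1)) ^ 2) →
      (∀ φ : Site d → Fin d → Matrix n n ℂ, IsSkewDir φ → IsPeriodicDir φ ((N * L ^ (k + 1) : ℕ) : ℤ) → TangentIter L k U φ →
        dAction U φ (perWin d (N * L ^ (k + 1))) = 0) → SmallField U (δ₁ / ((L : ℝ) ^ (k + 1)) ^ 2))
    -- THE HONEST PER-PAIR BINDER on the data class, at the pairs (U♯, U′)
    (hdecomp : ∀ D : Site d → Fin d → (Matrix n n ℂ)ˣ, IsUnitaryCfg D → IsPeriodicCfg D (N : ℤ) → SmallField D (4 * (Real.exp β - 1)) →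
      ∀ (k : ℕ), ∀ Us ∈ admissible (sfClass d L N ε) L (k + 1) D, SmallField Us (δ₁ / ((L : ℝ) ^ (k + 1)) ^ 2) →
      (∀ φ : Site d → Fin d → Matrix n n ℂ, IsSkewDir φ → IsPeriodicDir φ ((N * L ^ (k + 1) : ℕ) : ℤ) → TangentIter L k Us φ →
        dAction Us φ (perWin d (N * L ^ (k + 1))) = 0) →
      ∀ U' ∈ admissible (sfClass d L N ε) L (k + 1) D,
      ∃ (u : Site d → (Matrix n n ℂ)ˣ) (X XT XN : Site d → Fin d → Matrix n n ℂ) (α ν κ : ℝ),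
        IsUnitarySite u ∧ IsSkewDir X ∧ IsPeriodicDir X ((N * L ^ (k + 1) : ℕ) : ℤ) ∧ 0 ≤ α ∧ (∀ x μ, ‖X x μ‖ ≤ α) ∧
        gaugeAct u U' = vary Us X 1 ∧
        X = XT + XN ∧ XT ∈ 𝒯 k Us ∧ IsSkewDir XN ∧ 0 ≤ ν ∧
        energyNormW L (k + 1) Us XN (periodBox (d := d) (N * L ^ (k + 1)))
          ≤ ν * energyNormW L (k + 1) Us X (periodBox (d := d) (N * L ^ (k + 1))) ∧
        ε / ((L : ℝ) ^ (k + 1)) ^ 2 * (∑ p ∈ perWin d (N * L ^ (k + 1)), ‖curl Us XN p‖)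
          ≤ κ * energyNormW L (k + 1) Us X (periodBox (d := d) (N * L ^ (k + 1))) ^ 2 ∧
        α * (L : ℝ) ^ (k + 1) ≤ αh ∧ ν ≤ νh ∧ κ ≤ κh) :
    ∃ γ : ℝ, 0 < γ ∧ ∀ V : Site d → Fin d → (Matrix n n ℂ)ˣ, IsUnitaryCfg V → IsPeriodicCfg V (N : ℤ) → SmallField V γ →
      ∀ (k : ℕ) (U₀ : Site d → Fin d → (Matrix n n ℂ)ˣ), U₀ ∈ admissible (sfClass d L N ε) L (k + 1) V →
        SmallField U₀ (δ / ((L : ℝ) ^ k) ^ 2) →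
        ∃ U, IsMinimiser d (sfClass d L N ε) L N (k + 1) V U ∧ SmallField U (δ / ((L : ℝ) ^ (k + 1)) ^ 2) := by
  have hL1 : 1 ≤ L := by omega
  -- the data class and the side conditions as a set and a predicate, for F326's binder form
  let 𝒟 : Set (Site d → Fin d → (Matrix n n ℂ)ˣ) := {D | IsUnitaryCfg D ∧ IsPeriodicCfg D (N : ℤ) ∧ SmallField D (4 * (Real.exp β - 1))}
  let P : ℕ → (Site d → Fin d → (Matrix n n ℂ)ˣ) → (Site d → Fin d → (Matrix n n ℂ)ˣ) → Prop := fun k _ Us =>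
    SmallField Us (δ₁ / ((L : ℝ) ^ (k + 1)) ^ 2) ∧
      ∀ φ : Site d → Fin d → Matrix n n ℂ, IsSkewDir φ → IsPeriodicDir φ ((N * L ^ (k + 1) : ℕ) : ℤ) → TangentIter L k Us φ →
        dAction Us φ (perWin d (N * L ^ (k + 1))) = 0
  have hCP1 : 0 < 1 + CP := by linarith
  have hrep := hrep_of_hdecomp_generic (n := n) (𝒞 := sfClass d L N ε) (𝒟 := 𝒟) (P := P) (N := N) hL1 hCP1 hline 𝒯
    (fun D hD k Us hUs hPk U' hU' => hdecomp D hD.1 hD.2.1 hD.2.2 k Us hUs hPk.1 hPk.2 U' hU')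
  exact oneStep_of_dataClass_ape_rep_generic_gauge hL hN hε.le hε1 hε2 hδ₁ hδ₁δ hδε hCP hβ hls 𝒯 hT hP hape
    (fun D hDu hDP hDs k Us hUs hsm hcrit U' hU' => hrep D ⟨hDu, hDP, hDs⟩ k Us hUs ⟨hsm, hcrit⟩ U' hU')

/-! ## §2 `d = 4`, `L = 2`, SU(2) -/

/-- **ONE-STEP AT `d = 4`, `L = 2`, SU(2)∕U(2) (`card n = 2`), `0 < ε ≤ 10⁻⁵³`, FOR ALL `γ`-SMALL DATA ⇐ (APE) ∧ THE DECOMPOSITION BINDER ON `𝒟_β`**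
((P♮)_W, the level family and the class smallness DISCHARGED as in F31 §2; displayed: the ceilings and ONE k-free line). [folklore] -/
theorem oneStep_SU2_of_dataClass_ape_decomp [Nonempty n] (hn : Fintype.card n = 2) {N : ℕ} [NeZero N] (hN : 1 ≤ N) {ε δ δ₁ β : ℝ}
    (hε : 0 < ε) (hε' : ε ≤ 1 / 10 ^ 53) (hδ₁ : 0 ≤ δ₁) (hδ₁δ : δ₁ < δ) (hδε : δ < ε) (hβ : 0 < β)
    {αh νh κh : ℝ}
    (hline : 2 * κh < ((((1 / 2 - νh ^ 2) / (2 * (1 + (8 * CPLine 4 2 2 (1 / 10 ^ 17) (1 / 10 ^ 53) + 1))) - νh ^ 2) / 2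
        - 576 * (4 : ℕ) * (αh ^ 2 * Real.exp (2 * αh))) / (Fintype.card n : ℝ) - 28 * (4 : ℕ) * (ε + 7 * αh ^ 2)))
    (hape : ∀ D : Site 4 → Fin 4 → (Matrix n n ℂ)ˣ, IsUnitaryCfg D → IsPeriodicCfg D (N : ℤ) → SmallField D (4 * (Real.exp β - 1)) →
      ∀ (k : ℕ), ∀ U ∈ admissible (sfClass 4 2 N ε) 2 (k + 1) D, SmallField U (δ / ((((2 : ℕ) : ℝ)) ^ (k + 1)) ^ 2) →
      (∀ φ : Site 4 → Fin 4 → Matrix n n ℂ, IsSkewDir φ → IsPeriodicDir φ ((N * 2 ^ (k + 1) : ℕ) : ℤ) → TangentIter 2 k U φ →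
        dAction U φ (perWin 4 (N * 2 ^ (k + 1))) = 0) → SmallField U (δ₁ / ((((2 : ℕ) : ℝ)) ^ (k + 1)) ^ 2))
    (hdecomp : ∀ D : Site 4 → Fin 4 → (Matrix n n ℂ)ˣ, IsUnitaryCfg D → IsPeriodicCfg D (N : ℤ) → SmallField D (4 * (Real.exp β - 1)) →
      ∀ (k : ℕ), ∀ Us ∈ admissible (sfClass 4 2 N ε) 2 (k + 1) D, SmallField Us (δ₁ / ((((2 : ℕ) : ℝ)) ^ (k + 1)) ^ 2) →
      (∀ φ : Site 4 → Fin 4 → Matrix n n ℂ, IsSkewDir φ → IsPeriodicDir φ ((N * 2 ^ (k + 1) : ℕ) : ℤ) → TangentIter 2 k Us φ →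
        dAction Us φ (perWin 4 (N * 2 ^ (k + 1))) = 0) →
      ∀ U' ∈ admissible (sfClass 4 2 N ε) 2 (k + 1) D,
      ∃ (u : Site 4 → (Matrix n n ℂ)ˣ) (X XT XN : Site 4 → Fin 4 → Matrix n n ℂ) (α ν κ : ℝ),
        IsUnitarySite u ∧ IsSkewDir X ∧ IsPeriodicDir X ((N * 2 ^ (k + 1) : ℕ) : ℤ) ∧ 0 ≤ α ∧ (∀ x μ, ‖X x μ‖ ≤ α) ∧
        gaugeAct u U' = vary Us X 1 ∧
        X = XT + XN ∧ XT ∈ energyBlockLandauW (d := 4) (n := n) 2 N (k + 1) Us ∧ IsSkewDir XN ∧ 0 ≤ ν ∧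
        energyNormW 2 (k + 1) Us XN (periodBox (d := 4) (N * 2 ^ (k + 1)))
          ≤ ν * energyNormW 2 (k + 1) Us X (periodBox (d := 4) (N * 2 ^ (k + 1))) ∧
        ε / ((((2 : ℕ) : ℝ)) ^ (k + 1)) ^ 2 * (∑ p ∈ perWin 4 (N * 2 ^ (k + 1)), ‖curl Us XN p‖)
          ≤ κ * energyNormW 2 (k + 1) Us X (periodBox (d := 4) (N * 2 ^ (k + 1))) ^ 2 ∧
        α * (((2 : ℕ) : ℝ)) ^ (k + 1) ≤ αh ∧ ν ≤ νh ∧ κ ≤ κh) :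
    ∃ γ : ℝ, 0 < γ ∧ ∀ V : Site 4 → Fin 4 → (Matrix n n ℂ)ˣ, IsUnitaryCfg V → IsPeriodicCfg V (N : ℤ) → SmallField V γ →
      ∀ (k : ℕ) (U₀ : Site 4 → Fin 4 → (Matrix n n ℂ)ˣ), U₀ ∈ admissible (sfClass 4 2 N ε) 2 (k + 1) V →
        SmallField U₀ (δ / ((((2 : ℕ) : ℝ)) ^ k) ^ 2) →
        ∃ U, IsMinimiser 4 (sfClass 4 2 N ε) 2 N (k + 1) V U ∧ SmallField U (δ / ((((2 : ℕ) : ℝ)) ^ (k + 1)) ^ 2) := by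
  have hCP : 0 < 8 * CPLine 4 2 2 (1 / 10 ^ 17) (1 / 10 ^ 53) + 1 := by linarith [CPLine_nonneg_d4_L2]
  have hls := levelSmall_all_d4_L2 hε.le (hε'.trans (by norm_num))
  obtain ⟨hε1, hε2⟩ := classSmall_d4_L2 hε'
  exact oneStep_of_dataClass_ape_decomp (by norm_num) hN hε hε1 hε2 hδ₁ hδ₁δ hδε hCP hβ hls
    (fun j W => energyBlockLandauW (d := 4) (n := n) 2 N (j + 1) W)
    (fun j W hW F htan => hT_energyBlockLandau (by norm_num) hε.le hls j W hW F htan)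
    (fun j W hW => slicePoincare_mono (classSlicePoincare_energyBlockLandau_SU2 hn hN hε hε' j W hW) (by linarith)) hline hape hdecomp

end

end Summit.QuantumFields.BalabanUV.T4Continuum.NE7OneStepOfDecompositionSlice
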